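import Literature.MathematicalPhysics.QuantumLattice.InfVolFermionStatePointGroupAction
import HarnessLib

/-!
# `D₄` covariance of the `t–t'` Hubbard model on `ℤ²`, and the `D₄`-reduced window certificates read
# in EVERY translation-invariant ground state (orbit mean)

Topic `Literature/MathematicalPhysics/QuantumLattice`; namespace
`Literature.MathematicalPhysics.QuantumLattice` (the file path). Companion of
`InfVolFermionStatePointGroupAction.lean` (`d4Act`, `IsD4Invariant`) and of
`HubbardTTPrimeWindowCertificateAbstractState.lean` (the window certificate read in an abstract state).

§1 The linear action `d4Vec` of `D₄` on `ℤ²`: additive (`d4Vec_add`), a left action (`d4Vec_mul`, from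
   the torus statement `d4Site_mul_holds` at `L = 0`), permutes the unit and the diagonal steps and the
   sup-norm boxes, hence acts by automorphisms of BOTH bond graphs of the `t–t'` model
   (`zdGraph_two_adj_d4Vec_iff`, `diagAdj_d4Vec_iff`).
§2 Regions: `γ(Λ_R) + w = (γΛ + w)_R` (`d4ShiftSet_thicken`); `d4Emb γ w Λ` is a bijection and
   `Γ(d4Emb γ w Λ)` is the Bogoliubov relabelling of the induced orbital bijection
   (`fermionEmbed_d4Emb_eq_relabel`).
§3 **`Γ(d4Emb γ w Λ) H^{tt'}_Λ = H^{tt'}_{γΛ+w}`** (`fermionEmbed_d4Emb_hubbardTTPrime_localHamiltonian`, via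
   the two-graph form `hubbardTTPrime_localHamiltonian_eq_twoGraph` and `relabel_hamiltonian`) and
   `Γ(d4Emb γ w Λ) N_Λ = N_{γΛ+w}`: the `t–t'` Hubbard model on `ℤ²` is `D₄`-symmetric about every
   site — the infinite-lattice counterpart of `relabel_d4Perm_hubbardTorusTT'`.
§4 States: `ω ∘ γ` is translation invariant when `ω` is (`IsTranslationInvariant.d4Act`) and satisfies
   the Bratteli–Robinson ground-state condition for `H(t,t',U) − μN` when `ω` does
   (`d4Act_localStability_of_localStability`).
§5 **`re_sum_d4Act_expect_ge_of_window_certificate_TT'_ineq_of_groundState`**: a `D₄`-REDUCED window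
   certificate (arbitrary point-group labels) bounds the `D₄`-ORBIT MEAN
   `(1/8) Σ_{g∈D₄} Re (ω∘g)_{Λ'}(Xw)` of EVERY translation-invariant ground state `ω` of
   `H(t,t',U) − μN` with `0 < ρ(ω) < 2` whose transforms vanish on the charged words — no point-group
   symmetry of `ω` assumed (the defects cancel in the orbit sum,
   `IsTranslationInvariant.sum_d4Act_expect_d4Defect_eq_zero`). This is the abstract-state twin of
   `IsTorusLimitOf.re_sum_expect_d4_ge_of_window_certificate_TT'_ineq`; with `IsD4Invariant` it
   specialises to `…_of_groundState_of_isD4Invariant`.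

Sources: D. J. Scalapino, Phys. Rep. 250 (1995) §2 (the point group of the square lattice)
[Scalapino1995]; H. Xu et al. (2024) eq. (1) (the `t–t'` Hubbard Hamiltonian) [XuEtAl2024]; X. Han,
arXiv:2006.06002 §2 eq. (cons), §3.2 (symmetry constraints of the bootstrap) [Han2020Bootstrap];
J. Wang et al. (2024) §III (certified bounds hold for every state satisfying the constraints)
[WangEtAl2024]; O. Bratteli, D. W. Robinson, OAQSM 1 §4.3.1, OAQSM 2 Def. 5.3.18, Thm. 5.2.5
[BratteliRobinsonI1987, BratteliRobinsonII1997]. Everything is PROVED; no definitions, no named facts.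
-/

noncomputable section

namespace Literature.MathematicalPhysics.QuantumLattice

open Matrix Finset HubbardWave0 Literature.Probability.LatticeModels ThermodynamicLimit
open Literature.MathematicalPhysics.QuantumManyBody.StateRelaxation
open scoped ComplexOrder

/-! ### §1. The linear action of `D₄` on `ℤ²`: additivity, steps, boxes -/

section D4Linear

open DihedralGroup

/-- **`d4Vec γ` is additive**: `γ(x + y) = γx + γy`. [cite: Scalapino1995, §2] -/
theorem d4Vec_add (γ : DihedralGroup 4) (x y : Site 2) : d4Vec γ (x + y) = d4Vec γ x + d4Vec γ y := by
  have hrot1 : ∀ v w : Site 2, (![-(v + w) 1, (v + w) 0] : Site 2) = ![-v 1, v 0] + ![-w 1, w 0] := by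
    intro v w
    funext j
    fin_cases j <;> (simp; try omega)
  have hrefl1 : ∀ v w : Site 2, (![(v + w) 0, -(v + w) 1] : Site 2) = ![v 0, -v 1] + ![w 0, -w 1] := by
    intro v w
    funext j
    fin_cases j <;> (simp; try omega)
  have hrot : ∀ n : ℕ, ∀ v w : Site 2,
      (fun u : Site 2 => (![-u 1, u 0] : Site 2))^[n] (v + w) =
        (fun u : Site 2 => (![-u 1, u 0] : Site 2))^[n] v + (fun u : Site 2 => (![-u 1, u 0] : Site 2))^[n] w := by
    intro n
    induction n with
    | zero => intro v w; rfl
    | succ n ih =>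
      intro v w
      rw [Function.iterate_succ_apply', Function.iterate_succ_apply', Function.iterate_succ_apply', ih]
      exact hrot1 _ _
  cases γ with
  | r i => exact hrot i.val x y
  | sr i =>
    show (![((fun u : Site 2 => (![-u 1, u 0] : Site 2))^[i.val] (x + y)) 0,
        -((fun u : Site 2 => (![-u 1, u 0] : Site 2))^[i.val] (x + y)) 1] : Site 2) = _
    rw [hrot]
    exact hrefl1 _ _

/-- `γ 0 = 0` (the action is linear). [cite: Scalapino1995, §2] -/
theorem d4Vec_zero (γ : DihedralGroup 4) : d4Vec γ 0 = 0 := (d4Vec_eq_zero_iff γ 0).2 rfl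

/-- `γ(−x) = −γx` (the action is linear). [cite: Scalapino1995, §2] -/
theorem d4Vec_neg (γ : DihedralGroup 4) (x : Site 2) : d4Vec γ (-x) = -d4Vec γ x := by
  have h : d4Vec γ (-x) + d4Vec γ x = 0 := by rw [← d4Vec_add, neg_add_cancel, d4Vec_zero]
  exact eq_neg_of_add_eq_zero_left h

/-- `γ(x − y) = γx − γy` (the action is linear). [cite: Scalapino1995, §2] -/
theorem d4Vec_sub (γ : DihedralGroup 4) (x y : Site 2) : d4Vec γ (x - y) = d4Vec γ x - d4Vec γ y := by
  rw [sub_eq_add_neg, d4Vec_add, d4Vec_neg, ← sub_eq_add_neg]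

/-- **`d4Vec` is a (left) action of `D₄` on `ℤ²`**: `(gγ)x = g(γx)` — from the torus statement
`d4Site_mul_holds` read at `L = 0` (`(ℤ/0ℤ)² = ℤ²`, `Torus.proj 0 = id`). [cite: Scalapino1995, §2] -/
theorem d4Vec_mul (g γ : DihedralGroup 4) (x : Site 2) : d4Vec (g * γ) x = d4Vec g (d4Vec γ x) := by
  have hp : ∀ y : Site 2, Torus.proj 0 y = y := fun y => rfl
  have h1 := Torus.proj_d4Vec 0 (g * γ) x
  have h2 := Torus.proj_d4Vec 0 γ x
  have h3 := Torus.proj_d4Vec 0 g (d4Vec γ x)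
  rw [hp, hp] at h1 h2 h3
  have hm : ∀ (γ₁ γ₂ : DihedralGroup 4) (y : TorusSite 2 0), d4Site (γ₁ * γ₂) y = d4Site γ₁ (d4Site γ₂ y) :=
    fun γ₁ γ₂ y => d4Site_mul_holds γ₁ γ₂ y
  rw [h1, h3, h2]
  exact hm g γ x

/-- Nearest-neighbour adjacency of `ℤ²` in terms of the step set: `x ∼ y ↔ y − x ∈ {±e₁, ±e₂}`.
[cite: FriedliVelenik2017, §3.1] -/
theorem zdGraph_two_adj_iff_sub_mem_unitSteps (x y : Site 2) : (zdGraph 2).Adj x y ↔ y - x ∈ unitSteps := by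
  rw [zdGraph_adj_iff, Fin.exists_fin_two]
  simp only [unitSteps, Finset.mem_insert, Finset.mem_singleton]
  constructor
  · rintro ((h | h) | (h | h))
    · exact Or.inl (by rw [h]; abel)
    · exact Or.inr (Or.inl (by rw [h]; abel))
    · exact Or.inr (Or.inr (Or.inl (by rw [h]; abel)))
    · exact Or.inr (Or.inr (Or.inr (by rw [h]; abel)))
  · rintro (h | h | h | h)
    · exact Or.inl (Or.inl (by rw [← h]; abel))
    · refine Or.inl (Or.inr ?_)
      rw [← neg_neg (Pi.single (0 : Fin 2) (1 : ℤ) : Site 2), ← h]; abel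
    · exact Or.inr (Or.inl (by rw [← h]; abel))
    · refine Or.inr (Or.inr ?_)
      rw [← neg_neg (Pi.single (1 : Fin 2) (1 : ℤ) : Site 2), ← h]; abel

/-- **`D₄` acts by automorphisms of the nearest-neighbour graph of `ℤ²`.** [cite: Scalapino1995, §2] -/
theorem zdGraph_two_adj_d4Vec_iff (γ : DihedralGroup 4) (x y : Site 2) :
    (zdGraph 2).Adj (d4Vec γ x) (d4Vec γ y) ↔ (zdGraph 2).Adj x y := by
  rw [zdGraph_two_adj_iff_sub_mem_unitSteps, zdGraph_two_adj_iff_sub_mem_unitSteps, ← d4Vec_sub,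
    d4Vec_mem_unitSteps_iff]

/-- `diagVec 0 = (1, 1)`. [cite: XuEtAl2024, eq. (1)] -/
private theorem diagVec_zero_eq : diagVec 0 = ![1, 1] := by
  funext j; fin_cases j <;> simp [diagVec_apply_one]

/-- `diagVec 1 = (1, -1)`. [cite: XuEtAl2024, eq. (1)] -/
private theorem diagVec_one_eq : diagVec 1 = ![1, -1] := by
  funext j; fin_cases j <;> simp [diagVec_apply_one]

/-- Diagonal adjacency of `ℤ²` in terms of the diagonal step set `diagSteps = {±(e₁ + e₂), ±(e₁ − e₂)}`.
[cite: XuEtAl2024, eq. (1)] -/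
private theorem diagAdj_iff_sub_mem_diagSteps (x y : Site 2) :
    ((∃ s : Fin 2, y = x + diagVec s) ∨ ∃ s : Fin 2, x = y + diagVec s) ↔ y - x ∈ diagSteps := by
  have hn0 : -(![1, 1] : Site 2) = ![-1, -1] := by funext j; fin_cases j <;> simp
  have hn1 : -(![1, -1] : Site 2) = ![-1, 1] := by funext j; fin_cases j <;> simp
  rw [Fin.exists_fin_two, Fin.exists_fin_two, diagVec_zero_eq, diagVec_one_eq]
  simp only [diagSteps, Finset.mem_insert, Finset.mem_singleton]
  constructor
  · rintro ((h | h) | (h | h))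
    · exact Or.inl (by rw [h]; abel)
    · exact Or.inr (Or.inr (Or.inl (by rw [h]; abel)))
    · refine Or.inr (Or.inl ?_)
      rw [h, ← hn0]; abel
    · refine Or.inr (Or.inr (Or.inr ?_))
      rw [h, ← hn1]; abel
  · rintro (h | h | h | h)
    · exact Or.inl (Or.inl (by rw [← h]; abel))
    · refine Or.inr (Or.inl ?_)
      rw [← neg_neg (![1, 1] : Site 2), hn0, ← h]; abel
    · exact Or.inl (Or.inr (by rw [← h]; abel))
    · refine Or.inr (Or.inr ?_)
      rw [← neg_neg (![1, -1] : Site 2), hn1, ← h]; abel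

/-- `d4Vec γ` maps diagonal steps to diagonal steps. [cite: Scalapino1995, §2] -/
private theorem d4Vec_mem_diagSteps (γ : DihedralGroup 4) {e : Site 2} (he : e ∈ diagSteps) :
    d4Vec γ e ∈ diagSteps := by
  have hrot1 : ∀ v : Site 2, v ∈ diagSteps → (![-v 1, v 0] : Site 2) ∈ diagSteps := by
    intro v hv
    simp only [diagSteps, Finset.mem_insert, Finset.mem_singleton] at hv ⊢
    rcases hv with rfl | rfl | rfl | rfl <;> decide
  have hrefl1 : ∀ v : Site 2, v ∈ diagSteps → (![v 0, -v 1] : Site 2) ∈ diagSteps := by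
    intro v hv
    simp only [diagSteps, Finset.mem_insert, Finset.mem_singleton] at hv ⊢
    rcases hv with rfl | rfl | rfl | rfl <;> decide
  have hrot : ∀ n : ℕ, ∀ e : Site 2, e ∈ diagSteps →
      (fun v : Site 2 => (![-v 1, v 0] : Site 2))^[n] e ∈ diagSteps := by
    intro n
    induction n with
    | zero => intro e he; exact he
    | succ n ih => intro e he; rw [Function.iterate_succ_apply']; exact hrot1 _ (ih e he)
  cases γ with
  | r i => exact hrot i.val e he
  | sr i => exact hrefl1 _ (hrot i.val e he)

/-- **`d4Vec γ` permutes the four diagonal steps.** [cite: Scalapino1995, §2] -/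
theorem d4Vec_mem_diagSteps_iff (γ : DihedralGroup 4) (e : Site 2) :
    d4Vec γ e ∈ diagSteps ↔ e ∈ diagSteps := by
  refine ⟨fun h => ?_, d4Vec_mem_diagSteps γ⟩
  have himg : diagSteps.image (d4Vec γ) = diagSteps := by
    apply Finset.eq_of_subset_of_card_le
    · intro v hv
      obtain ⟨w, hw, rfl⟩ := Finset.mem_image.1 hv
      exact d4Vec_mem_diagSteps γ hw
    · rw [Finset.card_image_of_injective _ (d4Vec_injective γ)]
  rw [← himg] at h
  obtain ⟨w, hw, hwe⟩ := Finset.mem_image.1 h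
  rwa [← d4Vec_injective γ hwe]

/-- **`D₄` acts by automorphisms of the diagonal (`t'`) bond graph of `ℤ²`.** [cite: Scalapino1995, §2] -/
theorem diagAdj_d4Vec_iff (γ : DihedralGroup 4) (x y : Site 2) :
    ((∃ s : Fin 2, d4Vec γ y = d4Vec γ x + diagVec s) ∨ ∃ s : Fin 2, d4Vec γ x = d4Vec γ y + diagVec s) ↔
      ((∃ s : Fin 2, y = x + diagVec s) ∨ ∃ s : Fin 2, x = y + diagVec s) := by
  rw [diagAdj_iff_sub_mem_diagSteps, diagAdj_iff_sub_mem_diagSteps, ← d4Vec_sub, d4Vec_mem_diagSteps_iff]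

/-- **`D₄` preserves the sup-norm boxes** `{v : |vᵢ| ≤ n}`. [cite: Scalapino1995, §2] -/
theorem d4Vec_mem_box_iff (γ : DihedralGroup 4) (n : ℕ) (v : Site 2) : d4Vec γ v ∈ box 2 n ↔ v ∈ box 2 n := by
  have hrot1 : ∀ v : Site 2, (![-v 1, v 0] : Site 2) ∈ box 2 n ↔ v ∈ box 2 n := by
    intro v
    simp only [mem_box, Fin.forall_fin_two, Matrix.cons_val_zero, Matrix.cons_val_one]
    omega
  have hrefl1 : ∀ v : Site 2, (![v 0, -v 1] : Site 2) ∈ box 2 n ↔ v ∈ box 2 n := by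
    intro v
    simp only [mem_box, Fin.forall_fin_two, Matrix.cons_val_zero, Matrix.cons_val_one]
    omega
  have hrot : ∀ m : ℕ, ∀ v : Site 2, (fun u : Site 2 => (![-u 1, u 0] : Site 2))^[m] v ∈ box 2 n ↔ v ∈ box 2 n := by
    intro m
    induction m with
    | zero => intro v; rfl
    | succ m ih => intro v; rw [Function.iterate_succ_apply', hrot1, ih]
  cases γ with
  | r i => exact hrot i.val v
  | sr i => exact (hrefl1 _).trans (hrot i.val v)

end D4Linear

/-! ### §2. Regions: affine `D₄` images of thickenings; `d4Emb` is a bijection, `Γ(d4Emb)` a relabelling -/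

section Regions

/-- `d4ShiftSet γ w` is monotone. [folklore] -/
private theorem d4ShiftSet_mono' (γ : DihedralGroup 4) (w : Site 2) {Λ Λ' : Finset (Site 2)} (h : Λ ⊆ Λ') :
    d4ShiftSet γ w Λ ⊆ d4ShiftSet γ w Λ' :=
  Finset.map_subset_map.2 h

/-- Membership in an affine `D₄` image `γΛ + w`. [cite: Scalapino1995, §2] -/
theorem mem_d4ShiftSet_iff (γ : DihedralGroup 4) (w : Site 2) (Λ : Finset (Site 2)) (x : Site 2) :
    x ∈ d4ShiftSet γ w Λ ↔ ∃ y ∈ Λ, d4Vec γ y + w = x := by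
  unfold d4ShiftSet
  rw [Finset.mem_map]
  rfl

/-- `d4Vec γ` maps the box `{|vᵢ| ≤ n}` ONTO itself. [cite: Scalapino1995, §2] -/
theorem image_d4Vec_box (γ : DihedralGroup 4) (n : ℕ) : (box 2 n).image (d4Vec γ) = box 2 n := by
  apply Finset.eq_of_subset_of_card_le
  · intro v hv
    obtain ⟨u, hu, rfl⟩ := Finset.mem_image.1 hv
    exact (d4Vec_mem_box_iff γ n u).2 hu
  · rw [Finset.card_image_of_injective _ (d4Vec_injective γ)]

/-- **Affine `D₄` maps commute with thickening**: `γ(Λ_R) + w = (γΛ + w)_R` (the sup-norm balls of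
`ℤ²` are `D₄`-invariant). [cite: Scalapino1995, §2] -/
theorem d4ShiftSet_thicken (γ : DihedralGroup 4) (w : Site 2) (Λ : Finset (Site 2)) (R : ℝ) :
    d4ShiftSet γ w (thicken Λ R) = thicken (d4ShiftSet γ w Λ) R := by
  ext x
  simp only [mem_d4ShiftSet_iff, thicken, Finset.mem_biUnion, Finset.mem_image]
  constructor
  · rintro ⟨z, ⟨y, hy, v, hv, rfl⟩, rfl⟩
    exact ⟨d4Vec γ y + w, ⟨y, hy, rfl⟩, d4Vec γ v, (d4Vec_mem_box_iff γ _ v).2 hv,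
      by rw [d4Vec_add, add_right_comm]⟩
  · rintro ⟨y', ⟨y, hy, rfl⟩, v', hv', rfl⟩
    have hv'' : v' ∈ (box 2 ⌊R⌋₊).image (d4Vec γ) := by rwa [image_d4Vec_box]
    obtain ⟨v, hv, rfl⟩ := Finset.mem_image.1 hv''
    exact ⟨y + v, ⟨y, hy, v, hv, rfl⟩, by rw [d4Vec_add, add_right_comm]⟩

/-- `d4Emb γ w Λ : Λ → γΛ + w` is a bijection of site sets. [cite: Scalapino1995, §2] -/
theorem PolySite.d4Emb_bijective (γ : DihedralGroup 4) (w : Site 2) (Λ : Finset (Site 2)) :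
    Function.Bijective (PolySite.d4Emb γ w Λ) := by
  refine ⟨(PolySite.d4Emb γ w Λ).injective, fun z => ?_⟩
  obtain ⟨y, hy, hyz⟩ := (mem_d4ShiftSet_iff γ w Λ _).1 (PolySite.ofLex_mem z)
  refine ⟨PolySite.pt y hy, Subtype.ext ?_⟩
  show toLex (d4Vec γ (ofLex (toLex y)) + w) = z.1
  rw [ofLex_toLex, hyz, toLex_ofLex]

/-- **Along the bijection `d4Emb γ w Λ`, `Γ` is the Bogoliubov relabelling automorphism** of the
induced orbital bijection. [cite: BratteliRobinsonII1997, §5.2.2, Thm. 5.2.5] -/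
theorem fermionEmbed_d4Emb_eq_relabel (γ : DihedralGroup 4) (w : Site 2) (Λ : Finset (Site 2)) (A : FermionOp Λ) :
    fermionEmbed (PolySite.d4Emb γ w Λ) A =
      relabel (Orb.mapEquiv (Equiv.ofBijective _ (PolySite.d4Emb_bijective γ w Λ))) A := by
  rw [show fermionEmbed (PolySite.d4Emb γ w Λ) =
      fermionEmbed (Equiv.ofBijective _ (PolySite.d4Emb_bijective γ w Λ)).toEmbedding from
    fermionEmbed_congr fun _ => rfl, fermionEmbed_equiv]
  rfl

/-! ### §3. `D₄`-covariance of the `t–t'` local Hamiltonians and of the particle number -/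

/-- **The `t–t'` Hubbard model on `ℤ²` is `D₄`-symmetric about every site**: for every affine lattice
symmetry `x ↦ γx + w`, `Γ(d4Emb γ w Λ) H^{tt'}_Λ = H^{tt'}_{γΛ+w}` (both bond graphs — nearest-neighbour
and diagonal — are carried onto those of the image region; the on-site term is relabelled). The
infinite-lattice counterpart of the torus statement `relabel_d4Perm_hubbardTorusTT'`.
[cite: XuEtAl2024, eq. (1)] -/
theorem fermionEmbed_d4Emb_hubbardTTPrime_localHamiltonian (γ : DihedralGroup 4) (w : Site 2)
    (Λ : Finset (Site 2)) (t t' U : ℝ) :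
    fermionEmbed (PolySite.d4Emb γ w Λ) ((hubbardTTPrimeFermionInteraction t t' U).localHamiltonian Λ) =
      (hubbardTTPrimeFermionInteraction t t' U).localHamiltonian (d4ShiftSet γ w Λ) := by
  classical
  -- the diagonal bond graphs of the two regions (any graph realising the diagonal adjacency will do)
  let G₁ : SimpleGraph (PolySite Λ) :=
    { Adj := fun a b => (∃ s : Fin 2, ofLex b.1 = ofLex a.1 + diagVec s) ∨ ∃ s : Fin 2, ofLex a.1 = ofLex b.1 + diagVec s
      symm := ⟨fun _ _ h => Or.symm h⟩
      loopless := ⟨fun a h => by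
        rcases h with ⟨s, hs⟩ | ⟨s, hs⟩
        · exact self_ne_add_diagVec _ s hs
        · exact self_ne_add_diagVec _ s hs⟩ }
  haveI : DecidableRel G₁.Adj := fun a b => inferInstanceAs (Decidable (_ ∨ _))
  let G₂ : SimpleGraph (PolySite (d4ShiftSet γ w Λ)) :=
    { Adj := fun a b => (∃ s : Fin 2, ofLex b.1 = ofLex a.1 + diagVec s) ∨ ∃ s : Fin 2, ofLex a.1 = ofLex b.1 + diagVec s
      symm := ⟨fun _ _ h => Or.symm h⟩
      loopless := ⟨fun a h => by
        rcases h with ⟨s, hs⟩ | ⟨s, hs⟩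
        · exact self_ne_add_diagVec _ s hs
        · exact self_ne_add_diagVec _ s hs⟩ }
  haveI : DecidableRel G₂.Adj := fun a b => inferInstanceAs (Decidable (_ ∨ _))
  set e := Equiv.ofBijective _ (PolySite.d4Emb_bijective γ w Λ) with he_def
  have he : ∀ x : PolySite Λ, ofLex (e x).1 = d4Vec γ (ofLex x.1) + w := fun x => rfl
  have hpoly : ∀ x y : PolySite Λ, (polyGraph (d4ShiftSet γ w Λ)).Adj (e x) (e y) ↔ (polyGraph Λ).Adj x y := by
    intro x y
    rw [polyGraph_adj, polyGraph_adj, he x, he y, zdGraph_two_adj_iff_sub_mem_unitSteps,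
      add_sub_add_right_eq_sub, ← d4Vec_sub, d4Vec_mem_unitSteps_iff, ← zdGraph_two_adj_iff_sub_mem_unitSteps]
  have hdiag : ∀ x y : PolySite Λ, G₂.Adj (e x) (e y) ↔ G₁.Adj x y := by
    intro x y
    show ((∃ s : Fin 2, ofLex (e y).1 = ofLex (e x).1 + diagVec s) ∨
        ∃ s : Fin 2, ofLex (e x).1 = ofLex (e y).1 + diagVec s) ↔
      ((∃ s : Fin 2, ofLex y.1 = ofLex x.1 + diagVec s) ∨ ∃ s : Fin 2, ofLex x.1 = ofLex y.1 + diagVec s)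
    rw [he x, he y, diagAdj_iff_sub_mem_diagSteps, add_sub_add_right_eq_sub, ← d4Vec_sub,
      d4Vec_mem_diagSteps_iff, ← diagAdj_iff_sub_mem_diagSteps]
  rw [hubbardTTPrime_localHamiltonian_eq_twoGraph t' t U Λ G₁ (fun _ _ => Iff.rfl),
    hubbardTTPrime_localHamiltonian_eq_twoGraph t' t U (d4ShiftSet γ w Λ) G₂ (fun _ _ => Iff.rfl), map_add,
    fermionEmbed_d4Emb_eq_relabel, fermionEmbed_d4Emb_eq_relabel, ← he_def,
    relabel_hamiltonian (polyGraph Λ) (polyGraph (d4ShiftSet γ w Λ)) e hpoly t U,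
    relabel_hamiltonian G₁ G₂ e hdiag t' 0]

/-- **The particle number is `D₄`-covariant**: `Γ(d4Emb γ w Λ) N_Λ = N_{γΛ+w}` (a Bogoliubov relabelling
preserves the number operator sum). [cite: BratteliRobinsonII1997, §5.2.2, Thm. 5.2.5] -/
theorem fermionEmbed_d4Emb_totalNumber (γ : DihedralGroup 4) (w : Site 2) (Λ : Finset (Site 2)) :
    fermionEmbed (PolySite.d4Emb γ w Λ) (totalNumber : FermionOp Λ) = totalNumber := by
  rw [fermionEmbed_d4Emb_eq_relabel, relabel_mapEquiv_totalNumber]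

/-- `Γ(d4Emb γ w Λ) (H^{tt'}_Λ − μ N_Λ) = H^{tt'}_{γΛ+w} − μ N_{γΛ+w}`. [cite: XuEtAl2024, eq. (1)] -/
theorem fermionEmbed_d4Emb_hubbardTTPrime_localHamiltonian_sub_smul_totalNumber (γ : DihedralGroup 4)
    (w : Site 2) (Λ : Finset (Site 2)) (t t' U μ : ℝ) :
    fermionEmbed (PolySite.d4Emb γ w Λ)
        ((hubbardTTPrimeFermionInteraction t t' U).localHamiltonian Λ - (μ : ℂ) • (totalNumber : FermionOp Λ)) =
      (hubbardTTPrimeFermionInteraction t t' U).localHamiltonian (d4ShiftSet γ w Λ) -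
        (μ : ℂ) • (totalNumber : FermionOp (d4ShiftSet γ w Λ)) := by
  rw [map_sub, map_smul, fermionEmbed_d4Emb_hubbardTTPrime_localHamiltonian, fermionEmbed_d4Emb_totalNumber]

end Regions

/-! ### §4. States: `ω ∘ γ` is translation invariant and a ground state when `ω` is -/

namespace InfVolFermionState

/-- A region transport: `γ(Λ + v) ⊆ γΛ + γv` (they are equal). [folklore] -/
private theorem d4ShiftSet_zero_shiftSet_subset (γ : DihedralGroup 4) (v : Site 2) (Λ : Finset (Site 2)) :
    d4ShiftSet γ 0 (shiftSet v Λ) ⊆ shiftSet (d4Vec γ v) (d4ShiftSet γ 0 Λ) := by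
  intro x hx
  obtain ⟨z, hz, rfl⟩ := (mem_d4ShiftSet_iff γ 0 _ x).1 hx
  rw [mem_shiftSet] at hz
  rw [mem_shiftSet, mem_d4ShiftSet_iff]
  exact ⟨z - v, hz, by rw [d4Vec_sub, add_zero, add_zero]⟩

/-- **`ω ∘ γ` is translation invariant when `ω` is** (`τ_v ∘ γ = γ ∘ τ_{γ⁻¹ v}`: the translations are
normalised by the point group). [cite: BratteliRobinsonI1987, §4.3.1] -/
theorem IsTranslationInvariant.d4Act {ω : InfVolFermionState 2} (hω : ω.IsTranslationInvariant)
    (γ : DihedralGroup 4) : (ω.d4Act γ).IsTranslationInvariant := by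
  intro v
  refine InfVolFermionState.ext fun Λ => LinearMap.ext fun A => ?_
  have hsub := d4ShiftSet_zero_shiftSet_subset γ v Λ
  rw [shift_expect, d4Act_expect, d4Act_expect, ← ω.compatible hsub, fermionEmbed_fermionEmbed,
    fermionEmbed_fermionEmbed]
  conv_rhs => rw [← hω (d4Vec γ v), shift_expect, fermionEmbed_fermionEmbed]
  congr 2
  refine fermionEmbed_congr fun y => Subtype.ext ?_
  show toLex (d4Vec γ (ofLex y.1 + v) + 0) = toLex (d4Vec γ (ofLex y.1) + 0 + d4Vec γ v)
  rw [add_zero, add_zero, d4Vec_add]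

/-- Transport of the local-stability expression along an equality of regions. [folklore] -/
private theorem expect_stability_congr (ω : InfVolFermionState 2) {Λ Λa Λb : Finset (Site 2)} (e : Λa = Λb)
    (ha : Λ ⊆ Λa) (hb : Λ ⊆ Λb) (K : (Λ' : Finset (Site 2)) → FermionOp Λ') (A : FermionOp Λ) :
    ω.expect Λa ((fermionEmbed (PolySite.incl ha) A)ᴴ *
        (K Λa * fermionEmbed (PolySite.incl ha) A - fermionEmbed (PolySite.incl ha) A * K Λa)) =
      ω.expect Λb ((fermionEmbed (PolySite.incl hb) A)ᴴ *
        (K Λb * fermionEmbed (PolySite.incl hb) A - fermionEmbed (PolySite.incl hb) A * K Λb)) := by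
  subst e
  rfl

section GroundState

variable {ω : InfVolFermionState 2} {t t' U μc : ℝ}
variable (hgs : ∀ (Λ : Finset (Site 2)) (A : FermionOp Λ),
    0 ≤ (ω.expect (thicken Λ 1)
      ((fermionEmbed (PolySite.incl (subset_thicken Λ 1)) A)ᴴ *
        (((hubbardTTPrimeFermionInteraction t t' U).localHamiltonian (thicken Λ 1) -
              (μc : ℂ) • (totalNumber : FermionOp (thicken Λ 1))) *
            fermionEmbed (PolySite.incl (subset_thicken Λ 1)) A -
          fermionEmbed (PolySite.incl (subset_thicken Λ 1)) A *
            ((hubbardTTPrimeFermionInteraction t t' U).localHamiltonian (thicken Λ 1) -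
              (μc : ℂ) • (totalNumber : FermionOp (thicken Λ 1)))))).re)

include hgs in
/-- **Point-group images of ground states are ground states**: if `ω` is locally
`(H^{tt'}_{Λ₁} − μ_c N_{Λ₁})`-stable on every region (the Bratteli–Robinson ground-state condition for
`H(t,t',U) − μ_c N`), then so is `ω ∘ γ` for every `γ ∈ D₄` — because `H(t,t',U) − μ_c N` is
`D₄`-symmetric (`fermionEmbed_d4Emb_hubbardTTPrime_localHamiltonian_sub_smul_totalNumber`) and
`γ(Λ₁) = (γΛ)₁` (`d4ShiftSet_thicken`): an automorphism commuting with the dynamics maps ground states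
(Bratteli–Robinson II Def. 5.3.18, local stability) to ground states. [cite: BratteliRobinsonII1997, Def. 5.3.18] -/
theorem d4Act_localStability_of_localStability (γ : DihedralGroup 4) (Λ : Finset (Site 2)) (A : FermionOp Λ) :
    0 ≤ ((ω.d4Act γ).expect (thicken Λ 1)
      ((fermionEmbed (PolySite.incl (subset_thicken Λ 1)) A)ᴴ *
        (((hubbardTTPrimeFermionInteraction t t' U).localHamiltonian (thicken Λ 1) -
              (μc : ℂ) • (totalNumber : FermionOp (thicken Λ 1))) *
            fermionEmbed (PolySite.incl (subset_thicken Λ 1)) A -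
          fermionEmbed (PolySite.incl (subset_thicken Λ 1)) A *
            ((hubbardTTPrimeFermionInteraction t t' U).localHamiltonian (thicken Λ 1) -
              (μc : ℂ) • (totalNumber : FermionOp (thicken Λ 1)))))).re := by
  have hΛ : d4ShiftSet γ 0 Λ ⊆ d4ShiftSet γ 0 (thicken Λ 1) := d4ShiftSet_mono' γ 0 (subset_thicken Λ 1)
  -- `Γ(γ)` of the embedded local operator is the embedded `Γ(γ) A`
  have hA : fermionEmbed (PolySite.d4Emb γ 0 (thicken Λ 1)) (fermionEmbed (PolySite.incl (subset_thicken Λ 1)) A) =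
      fermionEmbed (PolySite.incl hΛ) (fermionEmbed (PolySite.d4Emb γ 0 Λ) A) := by
    rw [fermionEmbed_fermionEmbed, fermionEmbed_fermionEmbed]
    exact congrFun (congrArg DFunLike.coe (fermionEmbed_congr fun y => rfl)) A
  rw [d4Act_expect]
  simp only [map_mul, map_sub, map_smul, fermionEmbed_conjTranspose,
    fermionEmbed_d4Emb_hubbardTTPrime_localHamiltonian, fermionEmbed_d4Emb_totalNumber]
  rw [hA,
    ω.expect_stability_congr (d4ShiftSet_thicken γ 0 Λ 1) hΛ (subset_thicken (d4ShiftSet γ 0 Λ) 1)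
      (fun Λ' => (hubbardTTPrimeFermionInteraction t t' U).localHamiltonian Λ' - (μc : ℂ) • (totalNumber : FermionOp Λ'))]
  exact hgs (d4ShiftSet γ 0 Λ) (fermionEmbed (PolySite.d4Emb γ 0 Λ) A)

end GroundState

/-! ### §5. The `D₄`-orbit mean of every translation-invariant ground state obeys the `D₄`-reduced certificates -/

/-- `(γΛ + 0) + w ⊆ γΛ + w`. [folklore] -/
private theorem shiftSet_d4ShiftSet_zero_subset' (γ : DihedralGroup 4) (w : Site 2) (Λ : Finset (Site 2)) :
    shiftSet w (d4ShiftSet γ 0 Λ) ⊆ d4ShiftSet γ w Λ := by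
  intro x hx
  rw [mem_shiftSet, mem_d4ShiftSet_iff] at hx
  obtain ⟨y, hy, hyx⟩ := hx
  rw [mem_d4ShiftSet_iff]
  exact ⟨y, hy, by rw [← sub_add_cancel x w, ← hyx, add_zero]⟩

/-- **A translation-invariant state evaluated on an affine-`D₄` image is the transformed state**:
`ω_{Λ''}(Γ(incl)(Γ(d4Emb γ w Λ) Y)) = (ω ∘ γ)_Λ(Y)` (the translation part `w` is absorbed by
translation invariance). [cite: Han2020Bootstrap, §3.2 (U_α = {T_(1,0), T_(0,1), Π, R})] -/
theorem IsTranslationInvariant.expect_fermionEmbed_d4Emb {ω : InfVolFermionState 2} (hω : ω.IsTranslationInvariant)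
    {Λ Λ'' : Finset (Site 2)} (γ : DihedralGroup 4) (w : Site 2) (h : d4ShiftSet γ w Λ ⊆ Λ'') (Y : FermionOp Λ) :
    ω.expect Λ'' (fermionEmbed (PolySite.incl h) (fermionEmbed (PolySite.d4Emb γ w Λ) Y)) = (ω.d4Act γ).expect Λ Y := by
  rw [ω.compatible h, fermionEmbed_d4Emb_eq_shift γ w Λ (shiftSet_d4ShiftSet_zero_subset' γ w Λ), ω.compatible,
    ← shift_expect, hω w, d4Act_expect]

/-- `(gγ)Λ + g w ⊆ g Λ'` when `γΛ + w ⊆ Λ'`. [folklore] -/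
private theorem d4ShiftSet_mul_subset (g γ : DihedralGroup 4) (w : Site 2) {Λ Λ' : Finset (Site 2)}
    (hsh : d4ShiftSet γ w Λ ⊆ Λ') : d4ShiftSet (g * γ) (d4Vec g w) Λ ⊆ d4ShiftSet g 0 Λ' := by
  intro x hx
  obtain ⟨y, hy, rfl⟩ := (mem_d4ShiftSet_iff _ _ _ x).1 hx
  rw [mem_d4ShiftSet_iff]
  exact ⟨d4Vec γ y + w, hsh (d4Vec_add_mem_d4ShiftSet γ w hy), by rw [d4Vec_add, ← d4Vec_mul, add_zero]⟩

/-- `Γ(g) ∘ Γ(incl) ∘ Γ(γ· + w) = Γ(incl) ∘ Γ((gγ)· + g w)` on `𝔄_Λ`. [folklore] -/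
private theorem fermionEmbed_d4Emb_comp (g γ : DihedralGroup 4) (w : Site 2) {Λ Λ' : Finset (Site 2)}
    (hsh : d4ShiftSet γ w Λ ⊆ Λ') (Y : FermionOp Λ) :
    fermionEmbed (PolySite.d4Emb g 0 Λ') (fermionEmbed (PolySite.incl hsh) (fermionEmbed (PolySite.d4Emb γ w Λ) Y)) =
      fermionEmbed (PolySite.incl (d4ShiftSet_mul_subset g γ w hsh))
        (fermionEmbed (PolySite.d4Emb (g * γ) (d4Vec g w) Λ) Y) := by
  rw [fermionEmbed_fermionEmbed, fermionEmbed_fermionEmbed, fermionEmbed_fermionEmbed]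
  refine congrFun (congrArg DFunLike.coe (fermionEmbed_congr fun y => Subtype.ext ?_)) Y
  show toLex (d4Vec g (d4Vec γ (ofLex y.1) + w) + 0) = toLex (d4Vec (g * γ) (ofLex y.1) + d4Vec g w)
  rw [add_zero, d4Vec_add, d4Vec_mul]

/-- **The affine-`D₄` defects of a window certificate cancel in the `D₄`-orbit sum of a
translation-invariant state**: `Σ_{g ∈ D₄} (ω∘g)_{Λ'}(Γ(incl)(Γ(d4Emb γ w Λ) Y) − Γ(incl) Y) = 0`
(the first terms are `(ω∘gγ)_Λ(Y)`, a re-indexing of the second). The abstract-state form of the orbit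
argument of `IsTorusLimitOf.re_sum_expect_d4_ge_of_window_certificate_TT'_ineq`.
[cite: Han2020Bootstrap, §2 eq. (cons) and §3.2] -/
theorem IsTranslationInvariant.sum_d4Act_expect_d4Defect_eq_zero {ω : InfVolFermionState 2}
    (hω : ω.IsTranslationInvariant) {Λ Λ' : Finset (Site 2)} (hΛ : Λ ⊆ Λ') (γ : DihedralGroup 4) (w : Site 2)
    (hsh : d4ShiftSet γ w Λ ⊆ Λ') (Y : FermionOp Λ) :
    ∑ g : DihedralGroup 4, (ω.d4Act g).expect Λ'
      (fermionEmbed (PolySite.incl hsh) (fermionEmbed (PolySite.d4Emb γ w Λ) Y) - fermionEmbed (PolySite.incl hΛ) Y) = 0 := by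
  have h1 : ∀ g : DihedralGroup 4, (ω.d4Act g).expect Λ'
      (fermionEmbed (PolySite.incl hsh) (fermionEmbed (PolySite.d4Emb γ w Λ) Y)) = (ω.d4Act (g * γ)).expect Λ Y := by
    intro g
    rw [d4Act_expect, fermionEmbed_d4Emb_comp, hω.expect_fermionEmbed_d4Emb]
  have h2 : ∀ g : DihedralGroup 4, (ω.d4Act g).expect Λ' (fermionEmbed (PolySite.incl hΛ) Y) = (ω.d4Act g).expect Λ Y :=
    fun g => (ω.d4Act g).compatible hΛ Y
  simp_rw [map_sub, h1, h2]
  rw [Finset.sum_sub_distrib, sub_eq_zero]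
  exact Fintype.sum_equiv (Equiv.mulRight γ) _ _ fun g => rfl

/-- The expectation of `n_{xσ}` does not depend on the region it is read in. [folklore] -/
private theorem expect_nAt_eq_singleton (ω : InfVolFermionState 2) {Λ' : Finset (Site 2)} {x : Site 2}
    (hx : x ∈ Λ') (σ : Fin 2) :
    ω.expect Λ' (nAt x hx σ) = ω.expect {x} (nAt x (Finset.mem_singleton_self x) σ) := by
  rw [← ω.compatible (Finset.singleton_subset_iff.2 hx), fermionEmbed_numberOp, PolySite.incl_pt]

/-- **The density slots read the density**: `Σ_σ Re ω_{Λ'}(n_{0σ}) = ρ(ω)` for every window `Λ' ∋ 0`.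
[cite: ArakiMoriya2003, §4.1 (number operators)] -/
theorem sum_re_expect_nAt_zero_eq_density (ω : InfVolFermionState 2) {Λ' : Finset (Site 2)} (hz : (0 : Site 2) ∈ Λ') :
    ∑ σ : Fin 2, (ω.expect Λ' (nAt 0 hz σ)).re = ω.density := by
  rw [Fin.sum_univ_two, expect_nAt_eq_singleton ω hz 0, expect_nAt_eq_singleton ω hz 1, density, densityAt, map_add,
    Complex.add_re]

/-- **Spin-symmetric density multipliers give the torus-side density slot**: if `μ_↑ = μ_↓` then
`Σ_σ μ_σ (Re ω_{Λ'}(n_{0σ}) − ν) = (Σ_σ μ_σ)(ρ(ω)/2 − ν)` — the left side is the density slot of the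
abstract-state certificate theorems, the right side that of
`IsTorusLimitOf.re_sum_expect_d4_ge_of_window_certificate_TT'_ineq` at filling `n = ρ(ω)` (no spin
symmetry of `ω` needed). [cite: WangEtAl2024, §III] -/
theorem sum_mul_re_expect_nAt_zero_sub_eq (ω : InfVolFermionState 2) {Λ' : Finset (Site 2)} (hz : (0 : Site 2) ∈ Λ')
    (μ : Fin 2 → ℝ) (hμ : μ 0 = μ 1) (ν : ℝ) :
    ∑ σ : Fin 2, μ σ * ((ω.expect Λ' (nAt 0 hz σ)).re - ν) = (∑ σ : Fin 2, μ σ) * (ω.density / 2 - ν) := by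
  rw [← sum_re_expect_nAt_zero_eq_density ω hz, Fin.sum_univ_two, Fin.sum_univ_two, Fin.sum_univ_two, ← hμ]
  ring

/-- **The point group fixes the origin**: `(ω∘g)_{Λ'}(n_{0σ}) = ω_{Λ'}(n_{0σ})`. [cite: Scalapino1995, §2] -/
theorem d4Act_expect_nAt_zero (ω : InfVolFermionState 2) (g : DihedralGroup 4) {Λ' : Finset (Site 2)}
    (hz : (0 : Site 2) ∈ Λ') (σ : Fin 2) :
    (ω.d4Act g).expect Λ' (nAt 0 hz σ) = ω.expect Λ' (nAt 0 hz σ) := by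
  have hz' : (0 : Site 2) ∈ d4ShiftSet g 0 Λ' := by
    have h := d4Vec_add_mem_d4ShiftSet g 0 hz
    rwa [d4Vec_zero, add_zero] at h
  have hpt : PolySite.d4Emb g 0 Λ' (PolySite.pt 0 hz) = PolySite.pt 0 hz' := Subtype.ext (by
    show toLex (d4Vec g (ofLex (toLex (0 : Site 2))) + 0) = toLex 0
    rw [ofLex_toLex, d4Vec_zero, add_zero])
  rw [d4Act_expect, fermionEmbed_numberOp, hpt, expect_nAt_eq_singleton ω hz' σ, expect_nAt_eq_singleton ω hz σ]

/-- **`ω ∘ g` has the density of `ω`.** [cite: Scalapino1995, §2] -/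
theorem d4Act_density (ω : InfVolFermionState 2) (g : DihedralGroup 4) : (ω.d4Act g).density = ω.density := by
  simp only [density, densityAt, map_add, d4Act_expect_nAt_zero]

section GroundStateOrbit

variable {ω : InfVolFermionState 2} {t t' U μc : ℝ}
variable (hgs : ∀ (Λ : Finset (Site 2)) (A : FermionOp Λ),
    0 ≤ (ω.expect (thicken Λ 1)
      ((fermionEmbed (PolySite.incl (subset_thicken Λ 1)) A)ᴴ *
        (((hubbardTTPrimeFermionInteraction t t' U).localHamiltonian (thicken Λ 1) -
              (μc : ℂ) • (totalNumber : FermionOp (thicken Λ 1))) *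
            fermionEmbed (PolySite.incl (subset_thicken Λ 1)) A -
          fermionEmbed (PolySite.incl (subset_thicken Λ 1)) A *
            ((hubbardTTPrimeFermionInteraction t t' U).localHamiltonian (thicken Λ 1) -
              (μc : ℂ) • (totalNumber : FermionOp (thicken Λ 1)))))).re)

include hgs in
/-- **The `D₄`-REDUCED `t–t'` window certificates bound the `D₄`-orbit mean of EVERY
translation-invariant ground state of `H(t,t',U) − μ_c N` — no point-group symmetry of the state is
assumed.** Hypotheses as in `re_expect_ge_of_window_certificate_TT'_ineq_of_groundState`
(`HubbardTTPrimeWindowCertificateAbstractState.lean`) except that the point-group labels `γₗ` of the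
symmetry defects are ARBITRARY and the charged-word nulls are required of every `ω ∘ g`
(`g ∈ D₄`; they hold for every `U(1) × U(1)`-invariant `ω`). Conclusion:
`c − Σₖ ‖aₖ‖ + Σ_σ μ_σ (Re ω_{Λ'}(n_{0σ}) − ν) ≤ (1/8) Σ_{g ∈ D₄} Re (ω∘g)_{Λ'}(Xw)`.
Proof: each `ω ∘ g` is again a translation-invariant ground state with the same densities
(`IsTranslationInvariant.d4Act`, `d4Act_localStability_of_localStability`, `d4Act_density`), so it obeys
the certificate identity with the defects kept as a term
(`re_expect_ge_of_window_certificate_TT'_ineq_of_nulls`, eom rows by stationarity, energy slot by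
`meanEnergy_eq_energyDensityTT'_of_groundState`); the defect terms cancel in the orbit sum
(`sum_d4Act_expect_d4Defect_eq_zero`). This is the abstract-state twin of
`IsTorusLimitOf.re_sum_expect_d4_ge_of_window_certificate_TT'_ineq`. For a `D₄`-symmetric observable
read at a `D₄`-fixed place (e.g. the double occupancy `n_{0↑}n_{0↓}`) the orbit mean is `Re ω(Xw)` itself.
[cite: WangEtAl2024, §III] -/
theorem re_sum_d4Act_expect_ge_of_window_certificate_TT'_ineq_of_groundState
    (hω : ω.IsTranslationInvariant) (hU : 0 ≤ U) (hρ0 : 0 < ω.density) (hρ2 : ω.density < 2)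
    {Λ Λ' : Finset (Site 2)} (hΛ : Λ ⊆ Λ') (h8 : thicken Λ 1 ⊆ Λ')
    (h0 : thicken ({0} : Finset (Site 2)) 1 ⊆ Λ') (hz : (0 : Site 2) ∈ Λ')
    (Xw : FermionOp Λ') {κ u : ℝ} (hκ : 0 ≤ κ) (hu : energyDensityTT' t t' U ω.density ≤ u)
    (μ : Fin 2 → ℝ) (ν : ℝ)
    {m : Type*} [Fintype m] [DecidableEq m] {Λm : Matrix m m ℂ} (hΛm : Λm.PosSemidef)
    (O : m → FermionOp Λ')
    {κ' : Type*} (s : Finset κ') (B : κ' → FermionOp Λ) (hB : ∀ k ∈ s, Commute (B k) (totalNumber : FermionOp Λ))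
    {ι : Type*} (tt : Finset ι) (γ : ι → DihedralGroup 4) (wv : ι → Site 2)
    (hsh : ∀ l, d4ShiftSet (γ l) (wv l) Λ ⊆ Λ') (Y : ι → FermionOp Λ)
    {ρ : Type*} (uu : Finset ρ) (b : ρ → ℂ) (cw : ρ → List (Orb (PolySite Λ') × Bool))
    (hch : ∀ g : DihedralGroup 4, ∀ j ∈ uu, (ω.d4Act g).expect Λ' (ladderWord (cw j)) = 0)
    {δ : Type*} (ah : Finset δ) (dc : δ → ℝ) (V : δ → FermionOp Λ')
    {κ'' : Type*} (w : Finset κ'') (a : κ'' → ℂ) (word : κ'' → List (Orb (PolySite Λ') × Bool)) {c : ℝ}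
    (hcert : Xw - (c : ℂ) • (1 : FermionOp Λ') -
        ∑ σ : Fin 2, ((μ σ : ℝ) : ℂ) • (nAt 0 hz σ - ((ν : ℝ) : ℂ) • (1 : FermionOp Λ')) -
        ((κ : ℝ) : ℂ) • (((u : ℝ) : ℂ) • (1 : FermionOp Λ') -
          fermionEmbed (PolySite.incl h0) ((hubbardTTPrimeFermionInteraction t t' U).meanEnergyObs 1)) =
      gramForm Λm O +
        (∑ k ∈ s, ((hubbardTTPrimeFermionInteraction t t' U).localHamiltonian Λ' * fermionEmbed (PolySite.incl hΛ) (B k) -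
            fermionEmbed (PolySite.incl hΛ) (B k) * (hubbardTTPrimeFermionInteraction t t' U).localHamiltonian Λ') +
          ∑ l ∈ tt, (fermionEmbed (PolySite.incl (hsh l)) (fermionEmbed (PolySite.d4Emb (γ l) (wv l) Λ) (Y l)) -
            fermionEmbed (PolySite.incl hΛ) (Y l)) +
          ∑ j ∈ uu, b j • ladderWord (cw j)) +
        (∑ m' ∈ ah, ((dc m' : ℝ) : ℂ) • ((V m')ᴴ - V m') + ∑ k ∈ w, a k • ladderWord (word k))) :
    c - ∑ k ∈ w, ‖a k‖ + ∑ σ : Fin 2, μ σ * ((ω.expect Λ' (nAt 0 hz σ)).re - ν) ≤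
      (∑ g : DihedralGroup 4, ((ω.d4Act g).expect Λ' Xw).re) / 8 := by
  -- the defect operator, moved into the objective
  set D : FermionOp Λ' := ∑ l ∈ tt, (fermionEmbed (PolySite.incl (hsh l))
      (fermionEmbed (PolySite.d4Emb (γ l) (wv l) Λ) (Y l)) - fermionEmbed (PolySite.incl hΛ) (Y l)) with hD
  have hcert' : Xw - D - (c : ℂ) • (1 : FermionOp Λ') -
        ∑ σ : Fin 2, ((μ σ : ℝ) : ℂ) • (nAt 0 hz σ - ((ν : ℝ) : ℂ) • (1 : FermionOp Λ')) -
        ((κ : ℝ) : ℂ) • (((u : ℝ) : ℂ) • (1 : FermionOp Λ') -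
          fermionEmbed (PolySite.incl h0) ((hubbardTTPrimeFermionInteraction t t' U).meanEnergyObs 1)) =
      gramForm Λm O +
        (∑ k ∈ s, ((hubbardTTPrimeFermionInteraction t t' U).localHamiltonian Λ' * fermionEmbed (PolySite.incl hΛ) (B k) -
            fermionEmbed (PolySite.incl hΛ) (B k) * (hubbardTTPrimeFermionInteraction t t' U).localHamiltonian Λ') +
          ∑ l ∈ (∅ : Finset ι), (fermionEmbed (PolySite.incl (hsh l)) (fermionEmbed (PolySite.d4Emb (γ l) (wv l) Λ) (Y l)) -
            fermionEmbed (PolySite.incl hΛ) (Y l)) +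
          ∑ j ∈ uu, b j • ladderWord (cw j)) +
        (∑ m' ∈ ah, ((dc m' : ℝ) : ℂ) • ((V m')ᴴ - V m') + ∑ k ∈ w, a k • ladderWord (word k)) := by
    rw [Finset.sum_empty, add_zero,
      show Xw - D - (c : ℂ) • (1 : FermionOp Λ') -
          ∑ σ : Fin 2, ((μ σ : ℝ) : ℂ) • (nAt 0 hz σ - ((ν : ℝ) : ℂ) • (1 : FermionOp Λ')) -
          ((κ : ℝ) : ℂ) • (((u : ℝ) : ℂ) • (1 : FermionOp Λ') -
            fermionEmbed (PolySite.incl h0) ((hubbardTTPrimeFermionInteraction t t' U).meanEnergyObs 1)) =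
        Xw - (c : ℂ) • (1 : FermionOp Λ') -
          ∑ σ : Fin 2, ((μ σ : ℝ) : ℂ) • (nAt 0 hz σ - ((ν : ℝ) : ℂ) • (1 : FermionOp Λ')) -
          ((κ : ℝ) : ℂ) • (((u : ℝ) : ℂ) • (1 : FermionOp Λ') -
            fermionEmbed (PolySite.incl h0) ((hubbardTTPrimeFermionInteraction t t' U).meanEnergyObs 1)) - D from by abel,
      hcert]
    abel
  -- each `ω ∘ g` obeys the certificate with the defect term kept
  have hg : ∀ g : DihedralGroup 4,
      c - ∑ k ∈ w, ‖a k‖ + ∑ σ : Fin 2, μ σ * ((ω.expect Λ' (nAt 0 hz σ)).re - ν) ≤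
        ((ω.d4Act g).expect Λ' Xw).re - ((ω.d4Act g).expect Λ' D).re := by
    intro g
    have hgs' : ∀ (Λ : Finset (Site 2)) (A : FermionOp Λ), 0 ≤ ((ω.d4Act g).expect (thicken Λ 1)
        ((fermionEmbed (PolySite.incl (subset_thicken Λ 1)) A)ᴴ *
          (((hubbardTTPrimeFermionInteraction t t' U).localHamiltonian (thicken Λ 1) -
                (μc : ℂ) • (totalNumber : FermionOp (thicken Λ 1))) *
              fermionEmbed (PolySite.incl (subset_thicken Λ 1)) A -
            fermionEmbed (PolySite.incl (subset_thicken Λ 1)) A *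
              ((hubbardTTPrimeFermionInteraction t t' U).localHamiltonian (thicken Λ 1) -
                (μc : ℂ) • (totalNumber : FermionOp (thicken Λ 1)))))).re :=
      fun Λ A => d4Act_localStability_of_localStability hgs g Λ A
    have hTI : (ω.d4Act g).IsTranslationInvariant := hω.d4Act g
    have heom : ∀ k ∈ s, (ω.d4Act g).expect Λ'
        ((hubbardTTPrimeFermionInteraction t t' U).localHamiltonian Λ' * fermionEmbed (PolySite.incl hΛ) (B k) -
          fermionEmbed (PolySite.incl hΛ) (B k) * (hubbardTTPrimeFermionInteraction t t' U).localHamiltonian Λ') = 0 :=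
      fun k hk => expect_commutator_localHamiltonian_eq_zero_of_thicken_subset hgs' hΛ h8 (hB k hk)
    have h := (ω.d4Act g).re_expect_ge_of_window_certificate_TT'_ineq_of_nulls t t' U hΛ h0 hz (Xw - D) κ u μ ν
      hΛm O s B ∅ γ wv hsh Y uu b cw ah dc V w a word hcert' heom (fun l hl => absurd hl (Finset.notMem_empty l))
      (hch g)
    have he : (ω.d4Act g).meanEnergy (hubbardTTPrimeFermionInteraction t t' U) 1 =
        energyDensityTT' t t' U (ω.d4Act g).density :=
      meanEnergy_eq_energyDensityTT'_of_groundState hgs' hTI hU (by rw [d4Act_density]; exact hρ0)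
        (by rw [d4Act_density]; exact hρ2)
    rw [he, d4Act_density, map_sub, Complex.sub_re] at h
    simp_rw [d4Act_expect_nAt_zero] at h
    nlinarith [mul_nonneg hκ (sub_nonneg.2 hu)]
  -- the defect terms cancel in the orbit sum
  have hDsum : ∑ g : DihedralGroup 4, ((ω.d4Act g).expect Λ' D).re = 0 := by
    rw [← Complex.re_sum, hD]
    simp_rw [map_sum]
    rw [Finset.sum_comm, Finset.sum_eq_zero (fun l _ =>
      hω.sum_d4Act_expect_d4Defect_eq_zero hΛ (γ l) (wv l) (hsh l) (Y l)), Complex.zero_re]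
  have hsum := Finset.sum_le_sum fun g (_ : g ∈ (Finset.univ : Finset (DihedralGroup 4))) => hg g
  rw [Finset.sum_const, Finset.card_univ, Finset.sum_sub_distrib, hDsum, sub_zero] at hsum
  have hcard : Fintype.card (DihedralGroup 4) = 8 := by simp [DihedralGroup.card]
  rw [hcard, nsmul_eq_mul, Nat.cast_ofNat] at hsum
  rw [le_div_iff₀ (by norm_num : (0 : ℝ) < 8)]
  linarith

include hgs in
/-- **The `D₄`-orbit-mean bound — generators with null number commutators.** As
`re_sum_d4Act_expect_ge_of_window_certificate_TT'_ineq_of_groundState`, with the hypothesis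
`[Bₖ, N_Λ] = 0` on the eom generators weakened to `(ω∘g)_Λ(N_Λ Bₖ − Bₖ N_Λ) = 0` for every `g ∈ D₄`
(charged words `Bₖ` on which the `ω∘g` vanish are admitted; every `U(1)`-gauge-invariant `ω` qualifies
for every word), via `expect_commutator_localHamiltonian_eq_zero_of_expect_numberCommutator_eq_zero`.
[cite: WangEtAl2024, §III] -/
theorem re_sum_d4Act_expect_ge_of_window_certificate_TT'_ineq_of_groundState_of_numberCommutator_null
    (hω : ω.IsTranslationInvariant) (hU : 0 ≤ U) (hρ0 : 0 < ω.density) (hρ2 : ω.density < 2)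
    {Λ Λ' : Finset (Site 2)} (hΛ : Λ ⊆ Λ') (h8 : thicken Λ 1 ⊆ Λ')
    (h0 : thicken ({0} : Finset (Site 2)) 1 ⊆ Λ') (hz : (0 : Site 2) ∈ Λ')
    (Xw : FermionOp Λ') {κ u : ℝ} (hκ : 0 ≤ κ) (hu : energyDensityTT' t t' U ω.density ≤ u)
    (μ : Fin 2 → ℝ) (ν : ℝ)
    {m : Type*} [Fintype m] [DecidableEq m] {Λm : Matrix m m ℂ} (hΛm : Λm.PosSemidef)
    (O : m → FermionOp Λ')
    {κ' : Type*} (s : Finset κ') (B : κ' → FermionOp Λ)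
    (hB : ∀ g : DihedralGroup 4, ∀ k ∈ s, (ω.d4Act g).expect Λ ((totalNumber : FermionOp Λ) * B k - B k * totalNumber) = 0)
    {ι : Type*} (tt : Finset ι) (γ : ι → DihedralGroup 4) (wv : ι → Site 2)
    (hsh : ∀ l, d4ShiftSet (γ l) (wv l) Λ ⊆ Λ') (Y : ι → FermionOp Λ)
    {ρ : Type*} (uu : Finset ρ) (b : ρ → ℂ) (cw : ρ → List (Orb (PolySite Λ') × Bool))
    (hch : ∀ g : DihedralGroup 4, ∀ j ∈ uu, (ω.d4Act g).expect Λ' (ladderWord (cw j)) = 0)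
    {δ : Type*} (ah : Finset δ) (dc : δ → ℝ) (V : δ → FermionOp Λ')
    {κ'' : Type*} (w : Finset κ'') (a : κ'' → ℂ) (word : κ'' → List (Orb (PolySite Λ') × Bool)) {c : ℝ}
    (hcert : Xw - (c : ℂ) • (1 : FermionOp Λ') -
        ∑ σ : Fin 2, ((μ σ : ℝ) : ℂ) • (nAt 0 hz σ - ((ν : ℝ) : ℂ) • (1 : FermionOp Λ')) -
        ((κ : ℝ) : ℂ) • (((u : ℝ) : ℂ) • (1 : FermionOp Λ') -
          fermionEmbed (PolySite.incl h0) ((hubbardTTPrimeFermionInteraction t t' U).meanEnergyObs 1)) =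
      gramForm Λm O +
        (∑ k ∈ s, ((hubbardTTPrimeFermionInteraction t t' U).localHamiltonian Λ' * fermionEmbed (PolySite.incl hΛ) (B k) -
            fermionEmbed (PolySite.incl hΛ) (B k) * (hubbardTTPrimeFermionInteraction t t' U).localHamiltonian Λ') +
          ∑ l ∈ tt, (fermionEmbed (PolySite.incl (hsh l)) (fermionEmbed (PolySite.d4Emb (γ l) (wv l) Λ) (Y l)) -
            fermionEmbed (PolySite.incl hΛ) (Y l)) +
          ∑ j ∈ uu, b j • ladderWord (cw j)) +
        (∑ m' ∈ ah, ((dc m' : ℝ) : ℂ) • ((V m')ᴴ - V m') + ∑ k ∈ w, a k • ladderWord (word k))) :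
    c - ∑ k ∈ w, ‖a k‖ + ∑ σ : Fin 2, μ σ * ((ω.expect Λ' (nAt 0 hz σ)).re - ν) ≤
      (∑ g : DihedralGroup 4, ((ω.d4Act g).expect Λ' Xw).re) / 8 := by
  -- the defect operator, moved into the objective
  set D : FermionOp Λ' := ∑ l ∈ tt, (fermionEmbed (PolySite.incl (hsh l))
      (fermionEmbed (PolySite.d4Emb (γ l) (wv l) Λ) (Y l)) - fermionEmbed (PolySite.incl hΛ) (Y l)) with hD
  have hcert' : Xw - D - (c : ℂ) • (1 : FermionOp Λ') -
        ∑ σ : Fin 2, ((μ σ : ℝ) : ℂ) • (nAt 0 hz σ - ((ν : ℝ) : ℂ) • (1 : FermionOp Λ')) -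
        ((κ : ℝ) : ℂ) • (((u : ℝ) : ℂ) • (1 : FermionOp Λ') -
          fermionEmbed (PolySite.incl h0) ((hubbardTTPrimeFermionInteraction t t' U).meanEnergyObs 1)) =
      gramForm Λm O +
        (∑ k ∈ s, ((hubbardTTPrimeFermionInteraction t t' U).localHamiltonian Λ' * fermionEmbed (PolySite.incl hΛ) (B k) -
            fermionEmbed (PolySite.incl hΛ) (B k) * (hubbardTTPrimeFermionInteraction t t' U).localHamiltonian Λ') +
          ∑ l ∈ (∅ : Finset ι), (fermionEmbed (PolySite.incl (hsh l)) (fermionEmbed (PolySite.d4Emb (γ l) (wv l) Λ) (Y l)) -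
            fermionEmbed (PolySite.incl hΛ) (Y l)) +
          ∑ j ∈ uu, b j • ladderWord (cw j)) +
        (∑ m' ∈ ah, ((dc m' : ℝ) : ℂ) • ((V m')ᴴ - V m') + ∑ k ∈ w, a k • ladderWord (word k)) := by
    rw [Finset.sum_empty, add_zero,
      show Xw - D - (c : ℂ) • (1 : FermionOp Λ') -
          ∑ σ : Fin 2, ((μ σ : ℝ) : ℂ) • (nAt 0 hz σ - ((ν : ℝ) : ℂ) • (1 : FermionOp Λ')) -
          ((κ : ℝ) : ℂ) • (((u : ℝ) : ℂ) • (1 : FermionOp Λ') -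
            fermionEmbed (PolySite.incl h0) ((hubbardTTPrimeFermionInteraction t t' U).meanEnergyObs 1)) =
        Xw - (c : ℂ) • (1 : FermionOp Λ') -
          ∑ σ : Fin 2, ((μ σ : ℝ) : ℂ) • (nAt 0 hz σ - ((ν : ℝ) : ℂ) • (1 : FermionOp Λ')) -
          ((κ : ℝ) : ℂ) • (((u : ℝ) : ℂ) • (1 : FermionOp Λ') -
            fermionEmbed (PolySite.incl h0) ((hubbardTTPrimeFermionInteraction t t' U).meanEnergyObs 1)) - D from by abel,
      hcert]
    abel
  have hg : ∀ g : DihedralGroup 4,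
      c - ∑ k ∈ w, ‖a k‖ + ∑ σ : Fin 2, μ σ * ((ω.expect Λ' (nAt 0 hz σ)).re - ν) ≤
        ((ω.d4Act g).expect Λ' Xw).re - ((ω.d4Act g).expect Λ' D).re := by
    intro g
    have hgs' : ∀ (Λ : Finset (Site 2)) (A : FermionOp Λ), 0 ≤ ((ω.d4Act g).expect (thicken Λ 1)
        ((fermionEmbed (PolySite.incl (subset_thicken Λ 1)) A)ᴴ *
          (((hubbardTTPrimeFermionInteraction t t' U).localHamiltonian (thicken Λ 1) -
                (μc : ℂ) • (totalNumber : FermionOp (thicken Λ 1))) *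
              fermionEmbed (PolySite.incl (subset_thicken Λ 1)) A -
            fermionEmbed (PolySite.incl (subset_thicken Λ 1)) A *
              ((hubbardTTPrimeFermionInteraction t t' U).localHamiltonian (thicken Λ 1) -
                (μc : ℂ) • (totalNumber : FermionOp (thicken Λ 1)))))).re :=
      fun Λ A => d4Act_localStability_of_localStability hgs g Λ A
    have hTI : (ω.d4Act g).IsTranslationInvariant := hω.d4Act g
    have heom : ∀ k ∈ s, (ω.d4Act g).expect Λ'
        ((hubbardTTPrimeFermionInteraction t t' U).localHamiltonian Λ' * fermionEmbed (PolySite.incl hΛ) (B k) -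
          fermionEmbed (PolySite.incl hΛ) (B k) * (hubbardTTPrimeFermionInteraction t t' U).localHamiltonian Λ') = 0 :=
      fun k hk => expect_commutator_localHamiltonian_eq_zero_of_expect_numberCommutator_eq_zero hgs' hΛ h8 (hB g k hk)
    have h := (ω.d4Act g).re_expect_ge_of_window_certificate_TT'_ineq_of_nulls t t' U hΛ h0 hz (Xw - D) κ u μ ν
      hΛm O s B ∅ γ wv hsh Y uu b cw ah dc V w a word hcert' heom (fun l hl => absurd hl (Finset.notMem_empty l))
      (hch g)
    have he : (ω.d4Act g).meanEnergy (hubbardTTPrimeFermionInteraction t t' U) 1 =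
        energyDensityTT' t t' U (ω.d4Act g).density :=
      meanEnergy_eq_energyDensityTT'_of_groundState hgs' hTI hU (by rw [d4Act_density]; exact hρ0)
        (by rw [d4Act_density]; exact hρ2)
    rw [he, d4Act_density, map_sub, Complex.sub_re] at h
    simp_rw [d4Act_expect_nAt_zero] at h
    nlinarith [mul_nonneg hκ (sub_nonneg.2 hu)]
  have hDsum : ∑ g : DihedralGroup 4, ((ω.d4Act g).expect Λ' D).re = 0 := by
    rw [← Complex.re_sum, hD]
    simp_rw [map_sum]
    rw [Finset.sum_comm, Finset.sum_eq_zero (fun l _ =>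
      hω.sum_d4Act_expect_d4Defect_eq_zero hΛ (γ l) (wv l) (hsh l) (Y l)), Complex.zero_re]
  have hsum := Finset.sum_le_sum fun g (_ : g ∈ (Finset.univ : Finset (DihedralGroup 4))) => hg g
  rw [Finset.sum_const, Finset.card_univ, Finset.sum_sub_distrib, hDsum, sub_zero] at hsum
  have hcard : Fintype.card (DihedralGroup 4) = 8 := by simp [DihedralGroup.card]
  rw [hcard, nsmul_eq_mul, Nat.cast_ofNat] at hsum
  rw [le_div_iff₀ (by norm_num : (0 : ℝ) < 8)]
  linarith

/-- **A `U(1) × U(1)`-gauge-invariant state kills the charged words of every transform `ω ∘ g`**: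
if `ω` vanishes on every ladder word of non-zero particle or spin charge (in every region), then so
does `ω ∘ g`, `g ∈ D₄` (`Γ(d4Emb)` maps words to words with the same charges). This discharges the
hypothesis `hch` of the orbit-mean theorems from the CERTIFICATE-side hypothesis `hcw` of
`IsTorusLimitOf.re_sum_expect_d4_ge_of_window_certificate_TT'_ineq`. [cite: Han2020Bootstrap, §2 (charges C_α = {N, S_z})] -/
theorem d4Act_expect_ladderWord_eq_zero_of_charged (ω : InfVolFermionState 2)
    (hgauge : ∀ (Λ₀ : Finset (Site 2)) (l : List (Orb (PolySite Λ₀) × Bool)),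
      ladderCharge l ≠ 0 ∨ ladderSpinCharge l ≠ 0 → ω.expect Λ₀ (ladderWord l) = 0)
    (g : DihedralGroup 4) {Λ' : Finset (Site 2)} {l : List (Orb (PolySite Λ') × Bool)}
    (hl : ladderCharge l ≠ 0 ∨ ladderSpinCharge l ≠ 0) :
    (ω.d4Act g).expect Λ' (ladderWord l) = 0 := by
  rw [d4Act_expect, fermionEmbed_ladderWord]
  exact hgauge _ _ (by rwa [ladderCharge_map_embMap, ladderSpinCharge_map_embMap])

include hgs in
/-- **The `D₄`-orbit-mean bound for gauge-invariant translation-invariant ground states, with the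
certificate-side hypotheses of the torus-limit theorem.** As
`re_sum_d4Act_expect_ge_of_window_certificate_TT'_ineq_of_groundState`, with the state-side
charged-word nulls replaced by: `hcw` — every word of the charged-word family HAS non-zero particle or
spin charge (the hypothesis of `IsTorusLimitOf.re_sum_expect_d4_ge_of_window_certificate_TT'_ineq`,
checkable on the certificate) — and `hgauge` — `ω` vanishes on every charged ladder word
(`U(1) × U(1)` gauge invariance of the state). [cite: WangEtAl2024, §III] -/
theorem re_sum_d4Act_expect_ge_of_window_certificate_TT'_ineq_of_groundState_of_gaugeInvariant
    (hω : ω.IsTranslationInvariant) (hU : 0 ≤ U) (hρ0 : 0 < ω.density) (hρ2 : ω.density < 2)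
    (hgauge : ∀ (Λ₀ : Finset (Site 2)) (l : List (Orb (PolySite Λ₀) × Bool)),
      ladderCharge l ≠ 0 ∨ ladderSpinCharge l ≠ 0 → ω.expect Λ₀ (ladderWord l) = 0)
    {Λ Λ' : Finset (Site 2)} (hΛ : Λ ⊆ Λ') (h8 : thicken Λ 1 ⊆ Λ')
    (h0 : thicken ({0} : Finset (Site 2)) 1 ⊆ Λ') (hz : (0 : Site 2) ∈ Λ')
    (Xw : FermionOp Λ') {κ u : ℝ} (hκ : 0 ≤ κ) (hu : energyDensityTT' t t' U ω.density ≤ u)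
    (μ : Fin 2 → ℝ) (ν : ℝ)
    {m : Type*} [Fintype m] [DecidableEq m] {Λm : Matrix m m ℂ} (hΛm : Λm.PosSemidef)
    (O : m → FermionOp Λ')
    {κ' : Type*} (s : Finset κ') (B : κ' → FermionOp Λ) (hB : ∀ k ∈ s, Commute (B k) (totalNumber : FermionOp Λ))
    {ι : Type*} (tt : Finset ι) (γ : ι → DihedralGroup 4) (wv : ι → Site 2)
    (hsh : ∀ l, d4ShiftSet (γ l) (wv l) Λ ⊆ Λ') (Y : ι → FermionOp Λ)
    {ρ : Type*} (uu : Finset ρ) (b : ρ → ℂ) (cw : ρ → List (Orb (PolySite Λ') × Bool))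
    (hcw : ∀ j ∈ uu, ladderCharge (cw j) ≠ 0 ∨ ladderSpinCharge (cw j) ≠ 0)
    {δ : Type*} (ah : Finset δ) (dc : δ → ℝ) (V : δ → FermionOp Λ')
    {κ'' : Type*} (w : Finset κ'') (a : κ'' → ℂ) (word : κ'' → List (Orb (PolySite Λ') × Bool)) {c : ℝ}
    (hcert : Xw - (c : ℂ) • (1 : FermionOp Λ') -
        ∑ σ : Fin 2, ((μ σ : ℝ) : ℂ) • (nAt 0 hz σ - ((ν : ℝ) : ℂ) • (1 : FermionOp Λ')) -
        ((κ : ℝ) : ℂ) • (((u : ℝ) : ℂ) • (1 : FermionOp Λ') -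
          fermionEmbed (PolySite.incl h0) ((hubbardTTPrimeFermionInteraction t t' U).meanEnergyObs 1)) =
      gramForm Λm O +
        (∑ k ∈ s, ((hubbardTTPrimeFermionInteraction t t' U).localHamiltonian Λ' * fermionEmbed (PolySite.incl hΛ) (B k) -
            fermionEmbed (PolySite.incl hΛ) (B k) * (hubbardTTPrimeFermionInteraction t t' U).localHamiltonian Λ') +
          ∑ l ∈ tt, (fermionEmbed (PolySite.incl (hsh l)) (fermionEmbed (PolySite.d4Emb (γ l) (wv l) Λ) (Y l)) -
            fermionEmbed (PolySite.incl hΛ) (Y l)) +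
          ∑ j ∈ uu, b j • ladderWord (cw j)) +
        (∑ m' ∈ ah, ((dc m' : ℝ) : ℂ) • ((V m')ᴴ - V m') + ∑ k ∈ w, a k • ladderWord (word k))) :
    c - ∑ k ∈ w, ‖a k‖ + ∑ σ : Fin 2, μ σ * ((ω.expect Λ' (nAt 0 hz σ)).re - ν) ≤
      (∑ g : DihedralGroup 4, ((ω.d4Act g).expect Λ' Xw).re) / 8 :=
  re_sum_d4Act_expect_ge_of_window_certificate_TT'_ineq_of_groundState hgs hω hU hρ0 hρ2 hΛ h8 h0 hz Xw hκ hu μ ν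
    hΛm O s B hB tt γ wv hsh Y uu b cw
    (fun g j hj => ω.d4Act_expect_ladderWord_eq_zero_of_charged hgauge g (hcw j hj)) ah dc V w a word hcert

include hgs in
/-- **The `D₄`-orbit-mean bound in the torus theorem's shape.** For a `U(1) × U(1)`-gauge-invariant
translation-invariant ground state `ω` of `H(t,t',U) − μ_c N` with `0 < ρ(ω) < 2` and a `D₄`-reduced
certificate with spin-symmetric density multipliers `μ_↑ = μ_↓`, N-conserving eom generators and a
charged-word family of charged words (`hcw`):
`c − Σₖ ‖aₖ‖ + (Σ_σ μ_σ)(ρ(ω)/2 − ν) ≤ (1/8) Σ_{g∈D₄} Re (ω∘g)_{Λ'}(Xw)` — literally the left-hand side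
of `IsTorusLimitOf.re_sum_expect_d4_ge_of_window_certificate_TT'_ineq` at filling `n = ρ(ω)`, from the
same certificate data (`hcert`, `hcw`, `hsh`, `h8`, `h0`, `hz`, `κ ≥ 0`, `U ≥ 0`, `u`).
[cite: WangEtAl2024, §III] -/
theorem re_sum_d4Act_expect_ge_of_window_certificate_TT'_ineq_of_groundState_torusShape
    (hω : ω.IsTranslationInvariant) (hU : 0 ≤ U) (hρ0 : 0 < ω.density) (hρ2 : ω.density < 2)
    (hgauge : ∀ (Λ₀ : Finset (Site 2)) (l : List (Orb (PolySite Λ₀) × Bool)),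
      ladderCharge l ≠ 0 ∨ ladderSpinCharge l ≠ 0 → ω.expect Λ₀ (ladderWord l) = 0)
    {Λ Λ' : Finset (Site 2)} (hΛ : Λ ⊆ Λ') (h8 : thicken Λ 1 ⊆ Λ')
    (h0 : thicken ({0} : Finset (Site 2)) 1 ⊆ Λ') (hz : (0 : Site 2) ∈ Λ')
    (Xw : FermionOp Λ') {κ u : ℝ} (hκ : 0 ≤ κ) (hu : energyDensityTT' t t' U ω.density ≤ u)
    (μ : Fin 2 → ℝ) (hμ : μ 0 = μ 1) (ν : ℝ)
    {m : Type*} [Fintype m] [DecidableEq m] {Λm : Matrix m m ℂ} (hΛm : Λm.PosSemidef)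
    (O : m → FermionOp Λ')
    {κ' : Type*} (s : Finset κ') (B : κ' → FermionOp Λ) (hB : ∀ k ∈ s, Commute (B k) (totalNumber : FermionOp Λ))
    {ι : Type*} (tt : Finset ι) (γ : ι → DihedralGroup 4) (wv : ι → Site 2)
    (hsh : ∀ l, d4ShiftSet (γ l) (wv l) Λ ⊆ Λ') (Y : ι → FermionOp Λ)
    {ρ : Type*} (uu : Finset ρ) (b : ρ → ℂ) (cw : ρ → List (Orb (PolySite Λ') × Bool))
    (hcw : ∀ j ∈ uu, ladderCharge (cw j) ≠ 0 ∨ ladderSpinCharge (cw j) ≠ 0)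
    {δ : Type*} (ah : Finset δ) (dc : δ → ℝ) (V : δ → FermionOp Λ')
    {κ'' : Type*} (w : Finset κ'') (a : κ'' → ℂ) (word : κ'' → List (Orb (PolySite Λ') × Bool)) {c : ℝ}
    (hcert : Xw - (c : ℂ) • (1 : FermionOp Λ') -
        ∑ σ : Fin 2, ((μ σ : ℝ) : ℂ) • (nAt 0 hz σ - ((ν : ℝ) : ℂ) • (1 : FermionOp Λ')) -
        ((κ : ℝ) : ℂ) • (((u : ℝ) : ℂ) • (1 : FermionOp Λ') -
          fermionEmbed (PolySite.incl h0) ((hubbardTTPrimeFermionInteraction t t' U).meanEnergyObs 1)) =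
      gramForm Λm O +
        (∑ k ∈ s, ((hubbardTTPrimeFermionInteraction t t' U).localHamiltonian Λ' * fermionEmbed (PolySite.incl hΛ) (B k) -
            fermionEmbed (PolySite.incl hΛ) (B k) * (hubbardTTPrimeFermionInteraction t t' U).localHamiltonian Λ') +
          ∑ l ∈ tt, (fermionEmbed (PolySite.incl (hsh l)) (fermionEmbed (PolySite.d4Emb (γ l) (wv l) Λ) (Y l)) -
            fermionEmbed (PolySite.incl hΛ) (Y l)) +
          ∑ j ∈ uu, b j • ladderWord (cw j)) +
        (∑ m' ∈ ah, ((dc m' : ℝ) : ℂ) • ((V m')ᴴ - V m') + ∑ k ∈ w, a k • ladderWord (word k))) :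
    c - ∑ k ∈ w, ‖a k‖ + (∑ σ : Fin 2, μ σ) * (ω.density / 2 - ν) ≤
      (∑ g : DihedralGroup 4, ((ω.d4Act g).expect Λ' Xw).re) / 8 := by
  rw [← ω.sum_mul_re_expect_nAt_zero_sub_eq hz μ hμ ν]
  exact re_sum_d4Act_expect_ge_of_window_certificate_TT'_ineq_of_groundState_of_gaugeInvariant hgs hω hU hρ0 hρ2
    hgauge hΛ h8 h0 hz Xw hκ hu μ ν hΛm O s B hB tt γ wv hsh Y uu b cw hcw ah dc V w a word hcert

end GroundStateOrbit

end InfVolFermionState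

end Literature.MathematicalPhysics.QuantumLattice

end
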